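import Summits.FinalStateConjecture.FinalStateConjecture.Theorems.GapDecaySuffices.Negative.RelabelCovariance
import Summits.FinalStateConjecture.FinalStateConjecture.Statement

/-!
# The relabelled final state decomposition `d.relabel Δ` and covariance of the crux antecedent
# (`GapDecaySuffices`, crux stmt-FinalStateConjecture-18060 — negative side, support of
# `PosCoreFalseOfLabelSwapWitness.lean`)

Refuter seat `refuter-cdisprove-stmt-FinalStateConjecture-18060-0`, 2026-08-17.  Sorry-free, standard axioms.
Given a `Cᵏ` decomposition `d` and RELABELLING DATA `Δ` (model Poincaré map `P x = L x + p`, permutation `π` of the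
labels, slack `C` with `rᵢ(P y) ≤ r_{π i}(y) + C`: the new label line `P⁻¹ℓᵢ` is the old `ℓ_{π i}`), `d.relabel Δ`
(charts `Ψᵢ ∘ P`, labels `(L⁻¹Λᵢ, L⁻¹(cᵢ − p))`, excisions `ρ_{π i} + C`, flat chart unchanged) is a `Cᵏ` decomposition
of the SAME region with the same charted set and chart images, and `Hc`, `Hf` (slack `‖L‖²`), DV transfer
(`antecedent_relabel`).  `N = 2`, `π = (12)`, `P` the line-swapping involution: the input of `LabelSwapWitness`.
-/

noncomputable section

open scoped Manifold ContDiff Topology ENNReal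
open Filter Set Topology TopologicalSpace Literature.Geometry.Lorentzian

namespace Summit.FinalStateConjecture.FinalStateConjecture.Theorems.GapDecaySuffices.Negative.Relabel

set_option linter.dupNamespace false

section ModelInverse

variable (Λ L : lorentzGroup) (c p : E4) (M a : ℝ)

/-- `P (L⁻¹(y − p)) = y`. [folklore] -/
theorem affP_symm_sub (y : E4) : affP L p ((L : E4 ≃L[ℝ] E4).symm (y - p)) = y := by
  simp [affP]

/-- `L⁻¹(P x − p) = x`. [folklore] -/
theorem symm_affP_sub (x : E4) : (L : E4 ≃L[ℝ] E4).symm (affP L p x - p) = x := by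
  simp [affP]

/-- The inverse model map between the background domains. [folklore] -/
def preInv (y : (Bold Λ c M a).domain) : (Bnew Λ L c p M a).domain :=
  ⟨(L : E4 ≃L[ℝ] E4).symm (y.1 - p),
    (mem_boostedKerrExterior_relabel Λ L c p M a _).2 (by rw [affP_symm_sub]; exact y.2)⟩

/-- `P ∘ P⁻¹ = id` on the domains. [folklore] -/
@[simp] theorem pre_preInv (y : (Bold Λ c M a).domain) :
    pre Λ L c p M a (preInv Λ L c p M a y) = y :=
  Subtype.ext (affP_symm_sub L p y.1)

/-- `P⁻¹ ∘ P = id` on the domains. [folklore] -/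
@[simp] theorem preInv_pre (x : (Bnew Λ L c p M a).domain) :
    preInv Λ L c p M a (pre Λ L c p M a x) = x :=
  Subtype.ext (symm_affP_sub L p x.1)

/-- The model map is surjective onto the old domain. [folklore] -/
theorem pre_surjective : Function.Surjective (pre Λ L c p M a) :=
  fun y ↦ ⟨preInv Λ L c p M a y, pre_preInv Λ L c p M a y⟩

/-- The model map as a homeomorphism of the background domains. [folklore] -/
def preHomeo : (Bnew Λ L c p M a).domain ≃ₜ (Bold Λ c M a).domain where
  toFun := pre Λ L c p M a
  invFun := preInv Λ L c p M a
  left_inv := preInv_pre Λ L c p M a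
  right_inv := pre_preInv Λ L c p M a
  continuous_toFun := (contMDiff_pre Λ L c p M a).continuous
  continuous_invFun :=
    ((L : E4 ≃L[ℝ] E4).symm.continuous.comp (continuous_subtype_val.sub continuous_const)).subtype_mk _

/-- `(tᵢ, rᵢ)`-defined model sets of the new label are the `P`-preimages of the old ones. [folklore] -/
theorem preimage_pre_setOf (Q : ℝ → ℝ → Prop) :
    pre Λ L c p M a ⁻¹' {y | Q ((Bold Λ c M a).time y.1) ((Bold Λ c M a).radius y.1)} =
      {x | Q ((Bnew Λ L c p M a).time x.1) ((Bnew Λ L c p M a).radius x.1)} := by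
  ext x
  simp only [Set.mem_preimage, Set.mem_setOf_eq, pre_coe, time_relabel, radius_relabel]

/-- Chart images of `P`-corresponding model sets coincide. [folklore] -/
theorem image_comp_pre_preimage {α : Type*} (Ψ : (Bold Λ c M a).domain → α)
    (A : Set (Bold Λ c M a).domain) :
    (Ψ ∘ pre Λ L c p M a) '' (pre Λ L c p M a ⁻¹' A) = Ψ '' A := by
  rw [Set.image_comp, Set.image_preimage_eq A (pre_surjective Λ L c p M a)]

/-- Chart images of `(tᵢ, rᵢ)`-defined model sets coincide. [folklore] -/
theorem image_comp_pre_setOf {α : Type*} (Ψ : (Bold Λ c M a).domain → α) (Q : ℝ → ℝ → Prop) :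
    (Ψ ∘ pre Λ L c p M a) '' {x | Q ((Bnew Λ L c p M a).time x.1) ((Bnew Λ L c p M a).radius x.1)} =
      Ψ '' {y | Q ((Bold Λ c M a).time y.1) ((Bold Λ c M a).radius y.1)} := by
  rw [← preimage_pre_setOf, image_comp_pre_preimage]

/-- A late chart stays a late chart after relabelling (smoothness by composition; the open embedding
of the late region by composition with the homeomorphism of late regions; same image). [folklore] -/
theorem isLateChart_comp_pre {𝓢 : Spacetime.{0} 4} {𝒟 : Set 𝓢.carrier} {τ₀ : ℝ}
    {Ψ : (Bold Λ c M a).domain → 𝓢.carrier} (h : 𝓢.IsLateChart (Bold Λ c M a) 𝒟 τ₀ Ψ) :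
    𝓢.IsLateChart (Bnew Λ L c p M a) 𝒟 τ₀ (Ψ ∘ pre Λ L c p M a) where
  contMDiff := h.contMDiff.comp (contMDiff_pre Λ L c p M a)
  isOpenEmbedding := by
    have hset : ((Bnew Λ L c p M a).lateRegion τ₀ : Set _) =
        preHomeo Λ L c p M a ⁻¹' ((Bold Λ c M a).lateRegion τ₀) := by
      ext x
      simp only [ModelBackground.mem_lateRegion, Set.mem_preimage]
      show τ₀ < (Bnew Λ L c p M a).time x.1 ↔ τ₀ < (Bold Λ c M a).time (affP L p x.1)
      rw [time_relabel]
    have hcomp : ((Bnew Λ L c p M a).lateRegion τ₀).restrict (Ψ ∘ pre Λ L c p M a) =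
        ((Bold Λ c M a).lateRegion τ₀).restrict Ψ ∘ (preHomeo Λ L c p M a).sets hset := rfl
    rw [hcomp]
    exact h.isOpenEmbedding.comp (Homeomorph.isOpenEmbedding _)
  image_subset := by
    have : ((Bnew Λ L c p M a).lateRegion τ₀ : Set _) = pre Λ L c p M a ⁻¹' ((Bold Λ c M a).lateRegion τ₀) :=
      (preimage_pre_setOf Λ L c p M a fun t _ ↦ τ₀ < t).symm
    rw [this, image_comp_pre_preimage]
    exact h.image_subset

end ModelInverse

/-! ### The relabelled decomposition -/

section Decomposition

variable {𝓢 : Spacetime.{0} 4} {O : Set 𝓢.carrier} {k : ℕ}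

/-- **Relabelling data** for a decomposition `d`: a model Poincaré map `P x = L x + p`, a permutation
`π` of the labels and a slack `C` such that the Kerr–Schild radius of the relabelled label `i` is within
`C` of that of the old label `π i` at the same model point: `rᵢ(P y) ≤ r_{π i}(y) + C` — "the new label
line `P⁻¹ ℓᵢ` is the old line `ℓ_{π i}`" (for a swap of two lines by an exact `η`-isometry `P`,
`C = |aᵢ| + |a_{π i}|` by `‖z̄‖² − a² ≤ r² ≤ ‖z̄‖²`). [folklore] -/
structure RelabelData (d : FinalStateDecomposition 𝓢 O k) where
  /-- Lorentz part of `P`. -/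
  L : lorentzGroup
  /-- Translation part of `P`. -/
  p : E4
  /-- The permutation of the label lines induced by `P`. -/
  π : Equiv.Perm (Fin d.N)
  /-- Oblate-radius slack. -/
  C : ℝ
  /-- `rᵢ(P y) ≤ r_{π i}(y) + C`. -/
  radius_le : ∀ i (y : E4),
    (d.background i).radius (affP L p y) ≤ (d.background (π i)).radius y + C

variable (d : FinalStateDecomposition 𝓢 O k) (Δ : RelabelData d)

/-- The model map of label `i`. [folklore] -/
abbrev preOf (i : Fin d.N) :=
  pre (d.motion i).1 Δ.L (d.motion i).2 Δ.p (d.mass i) (d.spin i)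

/-- **The relabelled decomposition `d.relabel Δ`**: charts `Ψᵢ ∘ P` over the labels
`(L⁻¹Λᵢ, L⁻¹(cᵢ − p))`, excisions `ρ_{π i} + C`, flat chart and `τ₀` unchanged.  Same region `O`, same
regularity `k`. [folklore] -/
def relabel : FinalStateDecomposition 𝓢 O k where
  N := d.N
  mass := d.mass
  spin := d.spin
  mass_pos := d.mass_pos
  abs_spin_le_mass := d.abs_spin_le_mass
  motion i := (Δ.L⁻¹ * (d.motion i).1, (Δ.L : E4 ≃L[ℝ] E4).symm ((d.motion i).2 - Δ.p))
  τ₀ := d.τ₀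
  chart i := d.chart i ∘ preOf d Δ i
  isLateChart i := isLateChart_comp_pre _ _ _ _ _ _ (d.isLateChart i)
  tendsto_truncDeviationCk i R :=
    tendsto_truncDeviationCk_comp_pre (d.chart i) (d.isLateChart i).contMDiff k R
      (d.tendsto_truncDeviationCk i R)
  exists_pairwise_disjoint R := by
    obtain ⟨τ₁, h⟩ := d.exists_pairwise_disjoint R
    refine ⟨τ₁, fun i j hij ↦ ?_⟩
    have e : ∀ i, (d.chart i ∘ preOf d Δ i) ''
        (Bnew (d.motion i).1 Δ.L (d.motion i).2 Δ.p (d.mass i) (d.spin i)).truncLateRegion τ₁ R =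
        d.chart i '' (d.background i).truncLateRegion τ₁ R := fun i ↦
      image_comp_pre_setOf _ _ _ _ _ _ (d.chart i) fun t r ↦ τ₁ < t ∧ r ≤ R
    have := h hij
    simp only [Function.onFun] at this
    show Disjoint ((d.chart i ∘ preOf d Δ i) ''
        (Bnew (d.motion i).1 Δ.L (d.motion i).2 Δ.p (d.mass i) (d.spin i)).truncLateRegion τ₁ R)
      ((d.chart j ∘ preOf d Δ j) ''
        (Bnew (d.motion j).1 Δ.L (d.motion j).2 Δ.p (d.mass j) (d.spin j)).truncLateRegion τ₁ R)
    rw [e i, e j]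
    exact this
  excision i s := d.excision (Δ.π i) s + Δ.C
  tendsto_excision_div i := by
    have h1 := d.tendsto_excision_div (Δ.π i)
    have h2 : Tendsto (fun t : ℝ ↦ Δ.C / t) atTop (𝓝 0) := tendsto_const_nhds.div_atTop tendsto_id
    have := h1.add h2
    simp only [add_zero] at this
    refine this.congr' (Eventually.of_forall fun t ↦ ?_)
    show _ = (d.excision (Δ.π i) t + Δ.C) / t
    rw [add_div]
  flatDomain := d.flatDomain
  setOf_lt_excision_subset_flatDomain := by
    rintro x ⟨hx0, hx⟩
    refine d.setOf_lt_excision_subset_flatDomain ⟨hx0, fun j ↦ ?_⟩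
    have hj := hx (Δ.π.symm j)
    have hr := Δ.radius_le (Δ.π.symm j) x
    rw [Equiv.apply_symm_apply] at hr
    have hj' : d.excision (Δ.π (Δ.π.symm j)) (x 0) + Δ.C <
        (Bnew (d.motion (Δ.π.symm j)).1 Δ.L (d.motion (Δ.π.symm j)).2 Δ.p (d.mass (Δ.π.symm j))
          (d.spin (Δ.π.symm j))).radius x := hj
    rw [Equiv.apply_symm_apply, radius_relabel] at hj'
    change d.excision j (x 0) + Δ.C < (d.background (Δ.π.symm j)).radius (affP Δ.L Δ.p x) at hj'
    show d.excision j (x 0) < (d.background j).radius x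
    linarith
  flatChart := d.flatChart
  isLateChart_flat := d.isLateChart_flat
  tendsto_deviationCk_flat := d.tendsto_deviationCk_flat
  diff_subset_causalPast := by
    have e1 : ∀ i, (d.chart i ∘ preOf d Δ i) ''
        (Bnew (d.motion i).1 Δ.L (d.motion i).2 Δ.p (d.mass i) (d.spin i)).lateRegion d.τ₀ =
        d.chart i '' (d.background i).lateRegion d.τ₀ := fun i ↦
      image_comp_pre_setOf _ _ _ _ _ _ (d.chart i) fun t _ ↦ d.τ₀ < t
    have e2 : ∀ i, (d.chart i ∘ preOf d Δ i) ''
        (Bnew (d.motion i).1 Δ.L (d.motion i).2 Δ.p (d.mass i) (d.spin i)).timeSlab d.τ₀ =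
        d.chart i '' (d.background i).timeSlab d.τ₀ := fun i ↦
      image_comp_pre_setOf _ _ _ _ _ _ (d.chart i) fun t _ ↦ t = d.τ₀
    show O \ ((⋃ i, (d.chart i ∘ preOf d Δ i) ''
        (Bnew (d.motion i).1 Δ.L (d.motion i).2 Δ.p (d.mass i) (d.spin i)).lateRegion d.τ₀) ∪
        d.flatChart '' (Minkowski.backgroundOn d.flatDomain).lateRegion d.τ₀) ⊆
      𝓢.metric.causalPast 𝓢.timeOrientation ((⋃ i, (d.chart i ∘ preOf d Δ i) ''
        (Bnew (d.motion i).1 Δ.L (d.motion i).2 Δ.p (d.mass i) (d.spin i)).timeSlab d.τ₀) ∪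
        d.flatChart '' (Minkowski.backgroundOn d.flatDomain).timeSlab d.τ₀)
    simp only [e1, e2]
    exact d.diff_subset_causalPast

/-- The relabelled background of label `i` is the relabelled boosted Kerr background. [folklore] -/
theorem relabel_background (i : Fin d.N) :
    (relabel d Δ).background i =
      Bnew (d.motion i).1 Δ.L (d.motion i).2 Δ.p (d.mass i) (d.spin i) := rfl

/-- The relabelled chart of label `i` is `Ψᵢ ∘ P`. [folklore] -/
theorem relabel_chart (i : Fin d.N) : (relabel d Δ).chart i = d.chart i ∘ preOf d Δ i := rfl

/-- The black-hole regions are unchanged. [folklore] -/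
theorem relabel_region (i : Fin d.N) : (relabel d Δ).region i = d.region i :=
  image_comp_pre_setOf _ _ _ _ _ _ (d.chart i) fun t _ ↦ d.τ₀ < t

/-- The radiation zone is unchanged. [folklore] -/
theorem relabel_radiationZone : (relabel d Δ).radiationZone = d.radiationZone := rfl

/-- **The charted set is unchanged** — hence so is `exteriorOf 𝒟 d.charted`. [folklore] -/
theorem relabel_charted : (relabel d Δ).charted = d.charted := by
  simp only [FinalStateDecomposition.charted, relabel_radiationZone]
  congr 1
  exact Set.iUnion_congr (relabel_region d Δ)

end Decomposition

/-! ### Covariance of the crux antecedent: `Hc`, `Hf`, DV -/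

section Antecedent

variable {𝓢 : Spacetime.{0} 4} {O : Set 𝓢.carrier} {k : ℕ}

/-- The route's `HonestCore` bundle `Hc(d, R₀)` (body VERBATIM the `let Hc` of `Theses.StarvedNecks.NecksCertifyR`
/ `NeckGapDecay`, β-reduced). [folklore] -/
def HonestCoreOf (d : FinalStateDecomposition 𝓢 O k) (R₀ : ℝ) : Prop :=
  let B := d.background; let t := fun i ↦ (B i).time; let r := fun i ↦ (B i).radius; let Ψ := d.chart;
  (∀ i, Kerr.IsSubextremal (d.mass i) (d.spin i) ∧ 100 * d.mass i ≤ R₀ ∧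
      0 < ((d.motion i).1 : E4 ≃L[ℝ] E4) (E4.basisVector 0) 0) ∧
    (∀ i (ϱ τ₂ : ℝ), R₀ ≤ ϱ → d.τ₀ < τ₂ →
      Ψ i '' {x | d.τ₀ < t i x.1 ∧ t i x.1 < τ₂ ∧ r i x.1 < ϱ} ⊆
        𝓢.metric.causalPast 𝓢.timeOrientation (Ψ i '' (B i).truncTimeSlab ϱ τ₂)) ∧
    (∀ i (τ' : ℝ) (ϱ : ℝ → ℝ), Continuous ϱ → d.τ₀ < τ' →
      let A := Ψ i '' {x | τ' ≤ t i x.1 ∧ r i x.1 ≤ ϱ (t i x.1)}; closure A ∩ O ⊆ A) ∧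
    (∀ y : d.flatDomain, d.τ₀ < y.1 0 →
      𝓢.timeOrientation.IsFutureDirected (mfderiv 𝓘(ℝ, E4) (𝓡 4) d.flatChart y (E4.basisVector 0)))

/-- The route's `HonestFar` bundle `Hf(d, R₀)` (body VERBATIM the `let Hf` of the route decls). [folklore] -/
def HonestFarOf (d : FinalStateDecomposition 𝓢 O k) (R₀ : ℝ) : Prop :=
  let B := d.background; let t := fun i ↦ (B i).time; let r := fun i ↦ (B i).radius; let Φ := d.flatChart;
  (∀ τ₂ : ℝ, d.τ₀ < τ₂ → Φ '' {y | d.τ₀ < y.1 0 ∧ y.1 0 < τ₂} ⊆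
      𝓢.metric.causalPast 𝓢.timeOrientation (Φ '' (Minkowski.backgroundOn d.flatDomain).timeSlab τ₂)) ∧
    (∀ τ' : ℝ, d.τ₀ < τ' →
      closure (Φ '' {y | τ' ≤ y.1 0 ∧ ∀ i, d.excision i (y.1 0) + 1 ≤ r i y.1}) ⊆ Φ '' {y | τ' ≤ y.1 0}) ∧
    (∀ i, ∃ T : ℝ, supCkENorm (Subtype.val '' {x : (B i).domain | T ≤ t i x.1 ∧ R₀ ≤ r i x.1 ∧
        ∀ j, j ≠ i → r i x.1 ≤ r j x.1}) 0 (𝓢.deviationExtend (B i) (d.chart i)) ≤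
      ENNReal.ofReal (1 / (10 * ‖(((d.motion i).1 : E4 ≃L[ℝ] E4) : E4 →L[ℝ] E4)‖ ^ 2)))

/-- Pairwise distinct label four-velocities (the rev-3 repair C′). [folklore] -/
def DistinctLabels (d : FinalStateDecomposition 𝓢 O k) : Prop :=
  ∀ i j : Fin d.N, i ≠ j →
    ((d.motion i).1 : E4 ≃L[ℝ] E4) (E4.basisVector 0) ≠ ((d.motion j).1 : E4 ≃L[ℝ] E4) (E4.basisVector 0)

variable (d : FinalStateDecomposition 𝓢 O k) (Δ : RelabelData d) (R₀ : ℝ)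

/-- **`Hc` is relabelling-covariant** (given that `L⁻¹` keeps the labels orthochronous): the causal clauses
(2)(3) are statements about chart images of `(tᵢ, rᵢ)`-defined model sets, which are unchanged; (4) is about
the unchanged flat chart. [folklore] -/
theorem honestCore_relabel
    (horth : ∀ i, 0 < (((Δ.L⁻¹ * (d.motion i).1 : lorentzGroup) : E4 ≃L[ℝ] E4) (E4.basisVector 0)) 0)
    (h : HonestCoreOf d R₀) : HonestCoreOf (relabel d Δ) R₀ := by
  dsimp only [HonestCoreOf] at h ⊢
  obtain ⟨h1, h2, h3, h4⟩ := h
  refine ⟨fun i ↦ ⟨(h1 i).1, (h1 i).2.1, horth i⟩, fun i ϱ τ₂ hϱ hτ ↦ ?_, fun i τ' ϱ hϱ hτ ↦ ?_, h4⟩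
  · have e1 : (relabel d Δ).chart i '' {x | (relabel d Δ).τ₀ < ((relabel d Δ).background i).time x.1 ∧
          ((relabel d Δ).background i).time x.1 < τ₂ ∧ ((relabel d Δ).background i).radius x.1 < ϱ} =
        d.chart i '' {x | d.τ₀ < (d.background i).time x.1 ∧ (d.background i).time x.1 < τ₂ ∧
          (d.background i).radius x.1 < ϱ} :=
      image_comp_pre_setOf _ _ _ _ _ _ (d.chart i) fun t r ↦ d.τ₀ < t ∧ t < τ₂ ∧ r < ϱ
    have e2 : (relabel d Δ).chart i '' ((relabel d Δ).background i).truncTimeSlab ϱ τ₂ =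
        d.chart i '' (d.background i).truncTimeSlab ϱ τ₂ :=
      image_comp_pre_setOf _ _ _ _ _ _ (d.chart i) fun t r ↦ t = τ₂ ∧ r ≤ ϱ
    exact e1 ▸ e2 ▸ h2 i ϱ τ₂ hϱ hτ
  · have e1 : (relabel d Δ).chart i '' {x | τ' ≤ ((relabel d Δ).background i).time x.1 ∧
          ((relabel d Δ).background i).radius x.1 ≤ ϱ (((relabel d Δ).background i).time x.1)} =
        d.chart i '' {x | τ' ≤ (d.background i).time x.1 ∧
          (d.background i).radius x.1 ≤ ϱ ((d.background i).time x.1)} :=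
      image_comp_pre_setOf _ _ _ _ _ _ (d.chart i) fun t r ↦ τ' ≤ t ∧ r ≤ ϱ t
    exact e1 ▸ h3 i τ' ϱ hϱ hτ

/-- The relabelled Voronoi-type honest set of label `i` is sent by `P` into the old one (all labels move
by the same `P`, so `rᵢ' ≤ rⱼ'` is `rᵢ ∘ P ≤ rⱼ ∘ P`). [folklore] -/
theorem affP_image_honestSet_subset (i : Fin d.N) (T : ℝ) :
    affP Δ.L Δ.p '' (Subtype.val '' {x : ((relabel d Δ).background i).domain |
        T ≤ ((relabel d Δ).background i).time x.1 ∧ R₀ ≤ ((relabel d Δ).background i).radius x.1 ∧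
          ∀ j, j ≠ i → ((relabel d Δ).background i).radius x.1 ≤ ((relabel d Δ).background j).radius x.1}) ⊆
      Subtype.val '' {x : (d.background i).domain | T ≤ (d.background i).time x.1 ∧
        R₀ ≤ (d.background i).radius x.1 ∧
          ∀ j, j ≠ i → (d.background i).radius x.1 ≤ (d.background j).radius x.1} := by
  rintro _ ⟨y, ⟨x, ⟨hT, hR, hV⟩, rfl⟩, rfl⟩
  refine ⟨preOf d Δ i x, ⟨?_, ?_, fun j hj ↦ ?_⟩, rfl⟩
  · show T ≤ (Bold (d.motion i).1 (d.motion i).2 (d.mass i) (d.spin i)).time (affP Δ.L Δ.p x.1)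
    rw [← time_relabel]; exact hT
  · show R₀ ≤ (Bold (d.motion i).1 (d.motion i).2 (d.mass i) (d.spin i)).radius (affP Δ.L Δ.p x.1)
    rw [← radius_relabel]; exact hR
  · show (Bold (d.motion i).1 (d.motion i).2 (d.mass i) (d.spin i)).radius (affP Δ.L Δ.p x.1) ≤
      (Bold (d.motion j).1 (d.motion j).2 (d.mass j) (d.spin j)).radius (affP Δ.L Δ.p x.1)
    rw [← radius_relabel, ← radius_relabel]; exact hV j hj

/-- **`Hf` is relabelling-covariant, with slack `‖L‖²` in the `C⁰` threshold of `Hf`(3)**: the flat clauses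
(1)(2) are unchanged up to the inclusion of the new far set in the old one (excisions `ρ_{π i} + C`); (3)
follows from `supCkENorm_zero_comp_pre_le` over the `P`-corresponding honest sets, provided the old chart
meets the threshold `1/(10 ‖L‖² ‖L⁻¹Λᵢ‖²)` (eventually free for an input whose far deviation → 0).
[folklore] -/
theorem honestFar_relabel (h : HonestFarOf d R₀)
    (hslack : ∀ i, ∃ T : ℝ, supCkENorm (Subtype.val '' {x : (d.background i).domain |
        T ≤ (d.background i).time x.1 ∧ R₀ ≤ (d.background i).radius x.1 ∧
          ∀ j, j ≠ i → (d.background i).radius x.1 ≤ (d.background j).radius x.1}) 0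
        (𝓢.deviationExtend (d.background i) (d.chart i)) ≤
      ENNReal.ofReal (1 / (10 * (‖((Δ.L : E4 ≃L[ℝ] E4) : E4 →L[ℝ] E4)‖ ^ 2 *
        ‖(((Δ.L⁻¹ * (d.motion i).1 : lorentzGroup) : E4 ≃L[ℝ] E4) : E4 →L[ℝ] E4)‖ ^ 2)))) :
    HonestFarOf (relabel d Δ) R₀ := by
  dsimp only [HonestFarOf] at h ⊢
  obtain ⟨h1, h2, _⟩ := h
  refine ⟨h1, fun τ' hτ ↦ ?_, fun i ↦ ?_⟩
  · refine (closure_mono (Set.image_mono ?_)).trans (h2 τ' hτ)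
    rintro y ⟨hy0, hy⟩
    refine ⟨hy0, fun j ↦ ?_⟩
    have hj := hy (Δ.π.symm j)
    have hr := Δ.radius_le (Δ.π.symm j) y.1
    rw [Equiv.apply_symm_apply] at hr
    have hj' : d.excision (Δ.π (Δ.π.symm j)) (y.1 0) + Δ.C + 1 ≤
        (Bnew (d.motion (Δ.π.symm j)).1 Δ.L (d.motion (Δ.π.symm j)).2 Δ.p (d.mass (Δ.π.symm j))
          (d.spin (Δ.π.symm j))).radius y.1 := hj
    rw [Equiv.apply_symm_apply, radius_relabel] at hj'
    change d.excision j (y.1 0) + Δ.C + 1 ≤ (d.background (Δ.π.symm j)).radius (affP Δ.L Δ.p y.1) at hj'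
    show d.excision j (y.1 0) + 1 ≤ (d.background j).radius y.1
    linarith
  · obtain ⟨T, hT⟩ := hslack i
    refine ⟨T, ?_⟩
    change _ ≤ ENNReal.ofReal (1 / (10 *
      ‖(((Δ.L⁻¹ * (d.motion i).1 : lorentzGroup) : E4 ≃L[ℝ] E4) : E4 →L[ℝ] E4)‖ ^ 2))
    refine (supCkENorm_zero_comp_pre_le (d.chart i) (d.isLateChart i).contMDiff _).trans ?_
    refine (mul_le_mul' le_rfl ((supCkENorm_mono (affP_image_honestSet_subset d Δ R₀ i T) _ _).trans
      hT)).trans (le_of_eq ?_)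
    rw [← ENNReal.ofReal_mul (by positivity)]
    congr 1
    have hL : (0 : ℝ) < ‖((Δ.L : E4 ≃L[ℝ] E4) : E4 →L[ℝ] E4)‖ := (Δ.L : E4 ≃L[ℝ] E4).norm_pos
    have hΛ : (0 : ℝ) < ‖(((Δ.L⁻¹ * (d.motion i).1 : lorentzGroup) : E4 ≃L[ℝ] E4) : E4 →L[ℝ] E4)‖ :=
      ((Δ.L⁻¹ * (d.motion i).1 : lorentzGroup) : E4 ≃L[ℝ] E4).norm_pos
    field_simp

/-- **DV is relabelling-covariant** (`L⁻¹` is injective). [folklore] -/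
theorem distinctLabels_relabel (h : DistinctLabels d) : DistinctLabels (relabel d Δ) := by
  intro i j hij heq
  refine h i j hij ?_
  have e : ∀ i, (((relabel d Δ).motion i).1 : E4 ≃L[ℝ] E4) (E4.basisVector 0) =
      (Δ.L : E4 ≃L[ℝ] E4).symm (((d.motion i).1 : E4 ≃L[ℝ] E4) (E4.basisVector 0)) := fun i ↦ rfl
  rw [e, e] at heq
  exact (Δ.L : E4 ≃L[ℝ] E4).symm.injective heq

/-- **Covariance of the whole antecedent of the crux** (`O = exteriorOf`, `Hc`, `Hf`, DV) under relabelling,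
packaged: the relabelled input decomposes the SAME region with the SAME charted set and satisfies the three
bundles, given orthochronous relabelled labels and the `‖L‖²` slack in `Hf`(3). [folklore] -/
theorem antecedent_relabel {X : Type} [TopologicalSpace X] [ChartedSpace E3 X] [IsManifold (𝓡 3) ∞ X]
    [ConnectedSpace X] {D : InitialDataSet (𝓡 3) X} (𝒟 : VacuumCauchyDevelopment D)
    {O : Set 𝒟.carrier} (d : FinalStateDecomposition 𝒟.toSpacetime O k) (Δ : RelabelData d) (R₀ : ℝ)
    (hO : O = exteriorOf 𝒟.toCauchyDevelopment d.charted) (hc : HonestCoreOf d R₀) (hf : HonestFarOf d R₀)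
    (hdv : DistinctLabels d)
    (horth : ∀ i, 0 < (((Δ.L⁻¹ * (d.motion i).1 : lorentzGroup) : E4 ≃L[ℝ] E4) (E4.basisVector 0)) 0)
    (hslack : ∀ i, ∃ T : ℝ, supCkENorm (Subtype.val '' {x : (d.background i).domain |
        T ≤ (d.background i).time x.1 ∧ R₀ ≤ (d.background i).radius x.1 ∧
          ∀ j, j ≠ i → (d.background i).radius x.1 ≤ (d.background j).radius x.1}) 0
        (𝒟.toSpacetime.deviationExtend (d.background i) (d.chart i)) ≤
      ENNReal.ofReal (1 / (10 * (‖((Δ.L : E4 ≃L[ℝ] E4) : E4 →L[ℝ] E4)‖ ^ 2 *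
        ‖(((Δ.L⁻¹ * (d.motion i).1 : lorentzGroup) : E4 ≃L[ℝ] E4) : E4 →L[ℝ] E4)‖ ^ 2)))) :
    O = exteriorOf 𝒟.toCauchyDevelopment (relabel d Δ).charted ∧ HonestCoreOf (relabel d Δ) R₀ ∧
      HonestFarOf (relabel d Δ) R₀ ∧ DistinctLabels (relabel d Δ) :=
  ⟨by rw [relabel_charted]; exact hO, honestCore_relabel d Δ R₀ horth hc,
    honestFar_relabel d Δ R₀ hf hslack, distinctLabels_relabel d Δ hdv⟩

end Antecedent

end Summit.FinalStateConjecture.FinalStateConjecture.Theorems.GapDecaySuffices.Negative.Relabel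

end
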